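import Summits.QuantumFields.YangMills.Theorems.BalabanUVNodesN27AtRecordShadowTower
import Summits.QuantumFields.YangMills.Theorems.BalabanUVNodesN27AtRecordK4
import Summits.QuantumFields.YangMills.Theorems.BalabanUVNodesN27AtRecordReadings
import Literature.MathematicalPhysics.QuantumFieldTheory.Balaban1983to89.Node00.Record11CarriersB8

/-!
# BalabanUVNodes ∕ N27 = binder B5 AT THE RECORD, XX — THE ₁₁ RE-KEY: the (W2′) shadow ∕ tower closers, the K4∕K5 joins and the children's readings AT NODE 00's
# STAGE-11 RECORD PREDICATE `Node00.IsRecordOfRecord₁₁C` (`Node00/Record11.lean`, the §2 [III] format pin; the record the route's rev-1 K-items are keyed at),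
# its carrier-pinned refinements `IsRecordOfRecord₁₁CB10YZW` ∕ `…WB8` (`Record11Carriers(B8)`), and the K3 SHAPE «record → (B) → END → B5» at generic `N`
# (cell `pub-ymgap`, HUMAN RULING D-0062 Track A, R134 seat `pub-ymgap-dag-n27-c` (s2); `--supports stmt-QuantumFields-19676` = K3 `SpineGivenEndpointR11`; count-neutral)

WHY.  The route `BalabanUVNodes` was restated at ₁₁C (rev 6, 2026-08-26): K3 `SpineGivenEndpointR11` reads «at every Stage-11 record pair `(D, w)` (N = 2): (B)(D.C) →
END(D.C.toB12) → `T4ApexHybrid.HybridNE7Under D END`» — i.e. `Spine Rec₁₁C` with B5's own two antecedents displayed once more (§4).  Modules XII–XIX of the n27-a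
lineage typed N27 over a PARAMETER `Rec` and instantiated the (W2′) closer at ₉C (XVIII) and ₁₀C (XIX).  THIS FILE is the ₁₁ twin and the ₁₁ refresh of XVI∕XVII,
with the K4∕K5 joins (XIV) and the children's reading predicates (XV) keyed at ₁₁C BY NAME — nothing of XII–XIX, of NODE 00 or of the children's seats restated.

THE FIELD-BY-FIELD TABLE AT ₁₁ (which hypothesis of §3 fills which field of `T4MatchingAssembly.HybridNE7` — weight ∕ shell ∕ lt_one ∕ summable ∕ core — per
string, and where it comes from; «0∕1» = no producer at any record today):
* `weight`   ← N20 = NE7b: `S_N20 SRec` (`T4WeightBudget.RelWeightBound S.l₀ S.T S.A S.B S.Bad S.W` at the spine carriers), or XV's reading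
  `s_N20_of_extractionLawsReading` (two runs' `PinnedExtraction.ExtractionLaws` + the count, n20-a `N20Knit.relWeightBound_of_extractionLaws`).  0∕1.
* `shell`    ← N21 = NE7c: `S_N21 SRec` (`T4IndicatorShell.ShellWeightBound …`), or n21-a's reading `N21AtSpineCarriers.s_N21_of_slotLedgersReading`.  0∕1.
* `core`     ← N19′ = NE7 proper as the ∃δ-EDGE «`SRec … S → RRec … R → RatesAt D R → ∃ δ, Spine.NE7.Core … δ ∧ Summable δ`» (XIV `coreEdge_of_rateEdge`), fed by
  K4 = the six rate children at the rate carriers `RRec`: N14 `S_N14` (NE1′) · N15 `S_N15` (NE2) · N16 `S_N16` (NE3) · N17 `S_N17` (NE4; or GLUED from (D4) · N18 · N22,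
  `N17_of_U3edge`) · N18 `S_N18` (NE5) · N22 `S_N22` (NE9 + fading memory), existence `S_R00x Rec RRec`; or n19-a's PIN-FREE reading (XV `coreEdge_of_ledgerAtSyncReading`).  0∕1.
* `summable` ← the N19′ edge's `Summable δ` (U4′ RETIRED for B5: XII `spine_of_coreEdge`).
* `lt_one`   ← DERIVED in the tail from the two weights' own `summable` fields (XII `spineDatum_of_tail`, `T4MatchingClosure.eventually_budget_lt_one`) — never asked.
* `0 < l₀`, `0 < vol`, offset `K₀`, the E1∕E2 dictionary (class sums = `T4GenFunBounds.schemeZ (D.scheme g₀) os (K₀ + K)` ∕ `(K₀ + K + 1)`) ← the extraction stub `S_N27x Rec SRec`.  0∕1.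
The spine-carrier predicate `SRec` and the rate-carrier predicate `RRec` stay PARAMETERS (no rate-record home keyed to `Record11` exists in the tree today); only
`Rec` is instantiated, at `fun F D w => Node00.IsRecordOfRecord₁₁C F N D w` («₁₁C» below; likewise «₅C», «₁₁CB10YZW», «₁₁CB10YZWB8»).

WHAT IS KERNEL-CHECKED ([bookkeeping]; 0 `def`, 0 `sorry`; every step a tree theorem BY NAME).
* §1 SHADOW ROAD (XVI `b5_congr` ∕ `spine_of_shadow` ∘ Record11's `exists_isRecordOfRecord₅C_of_isRecordOfRecord₁₁C`): `b5_of_isRecordOfRecord₁₁C` · **`spine_rec11C_of_spine_rec5C`**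
  (`Spine ₅C → Spine ₁₁C`, the ₁₁ twin of XIX) · `b5_datumOfRecord₁₁_of_spine₅C` (B5 at EVERY Stage-11 datum of record `datumOfRecord₁₁ θ h`, `θ` admissible under its provisos —
  the world supplied by Record11's `exists_world_isRecordOfRecord₁₁C`).
* §1′ TOWER ROAD (XVII `spine_of_towerBound`): `towerBound_of_isRecordOfRecord₁₁C` — every ₁₁C pair IS tower-bound over the shadow parameters `shadow₅OfRecord₁₁ θ h w.γ` and the
  tower of record `towerOfRecord₁₁ θ h` (`hR` and `D = datumOfTower …` by `rfl`, Record11's `toCore_machineOfRecord₅_shadow₁₁`); `spine_rec11C_of_coarser` (B5 at any record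
  predicate coarser than ₅C ⇒ B5 at ₁₁C) is PROVED BY THE TOWER ROAD, so both roads of XVI∕XVII are exercised at ₁₁ and agree.
* §2 B5 READS THE DATUM, NOT THE WORLD: `spine_iff_datumClass` (`Spine Rec ↔` B5 on the datum class of `Rec`) · `spine_of_shadow_anyWorld` (XVI's closer with the shadow's
  world FREE) · `nonempty_opsY` (the [B9] operator-layer TYPE is inhabited by the zero layer — a type-level fact, NOT an object of record) · **`spine_rec11C_iff_spine_rec11CB10YZW`**,
  **`spine_rec11C_iff_spine_rec11CB10YZWB8`** — binder B5's obligation is THE SAME at the plain and at the carrier-pinned Stage-11 records (node00-def's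
  `isRecordOfRecord₁₁C_of_isRecordOfRecord₁₁CB10YZW` ∕ `…_rebind_of_isRecordOfRecord₁₁C` ∕ `companion_of_…B8` BY NAME; the residual layers from `nonempty_residZ∕W∕B8`, `nonempty_opsY`).
* §3 K4∕K5 AT ₁₁C (XIV∕XV by name): **`spine_rec11C_of_rateStubs_coreEdge`** (the seven K4 stubs + N27x · N20 · N21 · N19′ ⇒ `Spine ₁₁C`) · `spine_rec11C_of_rateStubs_coreEdge_glueN17` ·
  `spine_rec11C_of_rateStubs_coreEdge_rec5C` (the same stubs keyed at ₅C ⇒ `Spine ₁₁C`, §1 ∘ XIV) · `spine_rec11C_of_readings` (XV's three reading predicates at ₁₁C).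
* §4 THE K3 SHAPE at generic `N`: `k3Shape_iff_spine_rec11C` — «∀ F D w, ₁₁C → (B) D.C → END D.C.toB12 → HybridNE7Under D END» ↔ `Spine ₁₁C` ((B), END are B5's own antecedents:
  `T4ApexHybrid.HybridNE7Under D Hβ = D.UnderHypotheses Hβ _ = (B) → Hβ → ForSmallCouplings …`, definitional).  At `N = 2` the left side IS the route decl
  `Theses.BalabanUVNodes.SpineGivenEndpointR11` (module XXI states that face; this file does not import the route).

HONEST FRAMING.  COMPOSITE-node bookkeeping: the premise `Spine ₅C` ∕ every K4–K5 stub ∕ every reading is a HYPOTHESIS with NO producer at any record today (N19 ∕ N20 ∕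
N21 ∕ N27x ∕ R00x ∕ N14–N18 ∕ N22: 0∕1) — GAP-STATED here, located at the children; inhabitation of ₁₁C at `N ≥ 2` is K0 (open); nothing of Bałaban's is instantiated or
asserted; NE7 ∕ NE7b ∕ NE7c ∕ NE1′–NE9 are hypothesis shapes, none printed for the d = 4 procedure, none proved; NO node is discharged; typed 28∕28, the discharged count
is not touched; one finite four-torus programme at fixed ε — NOT ℝ⁴, NOT infinite volume, NOT OS, NOT a mass gap, NOT Clay.  Restate-immune (the route file is not
imported).  No decl below carries a cite tag.
-/

namespace Summit.QuantumFields.YangMills.Theorems.BalabanUVNodesN27SpineRecord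

open Literature.MathematicalPhysics.QuantumFieldTheory.Balaban1983to89
open Literature.MathematicalPhysics.QuantumFieldTheory.Balaban1983to89.T4Continuum
open Literature.MathematicalPhysics.QuantumFieldTheory.Balaban1983to89.T4DatumAssembly
open Summit.QuantumFields.BalabanUV.T4Continuum.Spine
open YMDAG.UVSplit
open scoped Matrix.Norms.L2Operator

/-! ## §1 The ₁₁C closer — SHADOW ROAD (XVI by name, Record11's refinement at the shadow) -/

section ShadowRoad

variable {N : ℕ} [NeZero N]

/-- **B5 AT ONE STAGE-11 RECORD PAIR from `Spine` at the ₅C record predicate**: the world of a ₁₁C record is a ₅C record at the shadow datum, which has the same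
`C` and `av` (`Node00.exists_isRecordOfRecord₅C_of_isRecordOfRecord₁₁C`), and B5 reads nothing else of the datum (XVI `b5_congr`).  The ₁₁ twin of XIX
`b5_of_isRecordOfRecord₁₀C`. [bookkeeping] -/
theorem b5_of_isRecordOfRecord₁₁C (h₅ : Spine (N := N) fun F D w => Node00.IsRecordOfRecord₅C F N D w)
    {F : T4Family} {D : Datum F N} {w : DagBinding.WorldP} (h : Node00.IsRecordOfRecord₁₁C F N D w) :
    T4ApexHybrid.HybridNE7Under D (DagBinding.EndpointExistence D.C.toB12) := by
  obtain ⟨D₅, h5, hC, -, -, hav⟩ := Node00.exists_isRecordOfRecord₅C_of_isRecordOfRecord₁₁C h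
  exact (b5_congr hC hav).mp (h₅ F D₅ w h5)

/-- **THE ₁₁C CLOSER OF THE COMPOSITE NODE**: `Spine ₅C → Spine ₁₁C` — one application of XVI `spine_of_shadow` to Record11's refinement at the shadow (the ₁₁ twin
of XIX `spine_rec10C_of_spine_rec5C`; the rev-1 K3 over ₁₁C consumes this shape, §4 ∕ module XXI). [bookkeeping] -/
theorem spine_rec11C_of_spine_rec5C (h₅ : Spine (N := N) fun F D w => Node00.IsRecordOfRecord₅C F N D w) :
    Spine (N := N) fun F D w => Node00.IsRecordOfRecord₁₁C F N D w :=
  spine_of_shadow (Rec' := fun F D w => Node00.IsRecordOfRecord₅C F N D w) (fun F D w h => by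
    obtain ⟨D₅, h5, hC, -, -, hav⟩ := Node00.exists_isRecordOfRecord₅C_of_isRecordOfRecord₁₁C h
    exact ⟨D₅, h5, hC, hav⟩) h₅

/-- **B5 AT EVERY STAGE-11 DATUM OF RECORD from `Spine` at ₅C**: for admissible Stage-11 parameters `θ` satisfying their displayed provisos, binder B5 holds at
`Node00.datumOfRecord₁₁ F N θ h` — the datum IS a ₁₁C record at some world (Record11's `exists_world_isRecordOfRecord₁₁C`, window `γw := θ.γ`, `0 < θ.γ` from
admissibility), and B5 does not read the world. [bookkeeping] -/
theorem b5_datumOfRecord₁₁_of_spine₅C (h₅ : Spine (N := N) fun F D w => Node00.IsRecordOfRecord₅C F N D w)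
    (F : T4Family) (θ : Node00.Stage11Params F N) (h : θ.Provisos₁₁) (hθ : θ.Admissible) :
    T4ApexHybrid.HybridNE7Under (Node00.datumOfRecord₁₁ F N θ h) (DagBinding.EndpointExistence (Node00.datumOfRecord₁₁ F N θ h).C.toB12) := by
  obtain ⟨w, hw, -⟩ := Node00.exists_world_isRecordOfRecord₁₁C F N θ h hθ (γw := θ.γ) ⟨hθ.1.1.1.1.2, le_rfl⟩
  exact b5_of_isRecordOfRecord₁₁C h₅ hw

end ShadowRoad

/-! ## §1′ The ₁₁C closer — TOWER ROAD (XVII by name): every Stage-11 record pair is tower-bound -/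

section TowerRoad

variable {N : ℕ} [NeZero N]

/-- **EVERY ₁₁C RECORD PAIR IS TOWER-BOUND** in the sense of XVII `spine_of_towerBound`: the datum IS the tower datum of the machine of the SHADOW Stage-5 parameters
`Node00.shadow₅OfRecord₁₁ F N θ h w.γ` (admissible: `admissible_shadow₁₁`) and the tower of record `Node00.towerOfRecord₁₁ F N θ h`, whose shadow operation IS the
shadow's residual `R` (`rfl`), the two data being the same term (`rfl`, Record11's `toCore_machineOfRecord₅_shadow₁₁`); the world is bound to it with the shadow's letters
(`γ` by `rfl`, `L`, the C-binding over the Stage-11 view = `upOfRecord₅C_shadow₁₁`, `rfl`). [bookkeeping] -/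
theorem towerBound_of_isRecordOfRecord₁₁C {F : T4Family} {D : Datum F N} {w : DagBinding.WorldP} (h : Node00.IsRecordOfRecord₁₁C F N D w) :
    ∃ (θ : Node00.Stage5Params F N) (_ : θ.Admissible) (τ : (Node00.machineOfRecord₅ F N θ).toCore.Tower (Node00.avOfRecord F N)),
      (∀ (p : B12.RunParams) (k : ℕ), θ.res.R p k = τ.shadowR p k) ∧
      D = datumOfTower F N (Node00.machineOfRecord₅ F N θ).toCore τ ∧
      w.C = D.C ∧ w.γ = θ.γ ∧ w.L = (θ.L : ℝ) ∧ (∀ P : B12.RunParams, w.up P = Node00.upOfRecord₅C F N θ P) := by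
  obtain ⟨θ, hP, hθ, rfl, hC, ⟨hγ0, -⟩, hL, hup⟩ := h
  exact ⟨Node00.shadow₅OfRecord₁₁ F N θ hP w.γ, Node00.admissible_shadow₁₁ F N θ hP hθ hγ0, Node00.towerOfRecord₁₁ F N θ hP,
    fun _ _ => rfl, rfl, hC, rfl, hL, hup⟩

/-- **Antitone corollary BY THE TOWER ROAD**: B5 at ANY record predicate coarser than ₅C gives B5 at ₁₁C — XII `spine_antitone`, then XVII `spine_of_towerBound` at the
tower-bound reading above (the second road to `spine_rec11C_of_spine_rec5C`'s conclusion; both roads agree). [bookkeeping] -/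
theorem spine_rec11C_of_coarser {Rec : RecordPred N}
    (hle : ∀ (F : T4Family) (D : Datum F N) (w : DagBinding.WorldP), Node00.IsRecordOfRecord₅C F N D w → Rec F D w) (h : Spine Rec) :
    Spine (N := N) fun F D w => Node00.IsRecordOfRecord₁₁C F N D w :=
  spine_of_towerBound N (fun _ _ _ h11 => towerBound_of_isRecordOfRecord₁₁C h11) (spine_antitone hle h)

end TowerRoad

/-! ## §2 B5 reads the DATUM, not the world: the datum-class reading, the any-world shadow closer, carrier-suffix invariance at Stage 11 -/

section DatumClass

variable {N : ℕ} [NeZero N]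

/-- **`Spine Rec` IS A STATEMENT ABOUT THE DATUM CLASS OF `Rec`**: B5 at every record pair ⟺ B5 at every datum carried by SOME world of `Rec` (the world enters
`Spine` only through the guard `Rec F D w`). [bookkeeping] -/
theorem spine_iff_datumClass (Rec : RecordPred N) :
    Spine Rec ↔ ∀ (F : T4Family) (D : Datum F N), (∃ w : DagBinding.WorldP, Rec F D w) →
      T4ApexHybrid.HybridNE7Under D (DagBinding.EndpointExistence D.C.toB12) :=
  ⟨fun h F D ⟨w, hR⟩ => h F D w hR, fun h F D w hR => h F D ⟨w, hR⟩⟩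

/-- **`Spine` TRANSFERS ALONG `(C, av)`-SHADOWS AT ANY WORLD** (XVI `spine_of_shadow` with the shadow pair's world FREE): if every pair `(D, w)` of `Rec` has a pair
`(D', w')` of `Rec'` with `D'.C = D.C`, `D'.av = D.av`, then `Spine Rec' → Spine Rec` (`b5_congr`). [bookkeeping] -/
theorem spine_of_shadow_anyWorld {Rec Rec' : RecordPred N}
    (hsh : ∀ (F : T4Family) (D : Datum F N) (w : DagBinding.WorldP), Rec F D w →
      ∃ (D' : Datum F N) (w' : DagBinding.WorldP), Rec' F D' w' ∧ D'.C = D.C ∧ D'.av = D.av)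
    (h : Spine Rec') : Spine Rec := by
  intro F D w hR
  obtain ⟨D', w', hR', hC, hav⟩ := hsh F D w hR
  exact (b5_congr hC hav).mp (h F D' w' hR')

/-- **The [B9] operator-layer TYPE `Node00.OpsY N θ₃ M⋆` is inhabited** — by the ZERO layer (all kernels `0`, all predicates `True`, one-point walk types).  A
type-level fact used only to re-bind worlds below; NOT an object of record (Bałaban's propagators are the unassigned XL layer). [bookkeeping] -/
theorem nonempty_opsY (N : ℕ) (θ₃ : Node00.Stage3Params) (Mstar : ℕ) : Nonempty (Node00.OpsY N θ₃ Mstar) :=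
  ⟨fun _ =>
    { Gp := ⟨fun _ _ _ _ => 0, fun _ _ _ _ => 0, fun _ _ _ => 0, fun _ _ _ _ => 0, fun _ _ _ _ => 0, fun _ _ _ _ => 0⟩
      GA := ⟨fun _ _ _ _ => 0, fun _ _ _ _ => 0, fun _ _ _ => 0, fun _ _ _ _ => 0, fun _ _ _ _ => 0, fun _ _ _ _ => 0⟩
      Cinv := ⟨fun _ _ _ => 0⟩
      IsAnalyticExt := fun _ _ _ => True
      E37 := ⟨PUnit, fun _ => 0, fun _ _ => True, fun _ _ => True, fun _ _ _ => 0, fun _ _ _ _ => 0, fun _ _ => True, fun _ => True⟩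
      EK39 := ⟨PUnit, fun _ => 0, fun _ _ _ => 0, fun _ _ _ _ => 0, fun _ _ => True, fun _ => True⟩
      E310 := ⟨PUnit, fun _ => 0, fun _ _ => True, fun _ _ => True, fun _ _ _ => 0, fun _ _ _ _ => 0, fun _ _ => True, fun _ => True⟩
      PosDef := fun _ _ => True
      GD := ⟨fun _ _ _ _ => 0, fun _ _ _ _ => 0, fun _ _ _ => 0, fun _ _ _ _ => 0, fun _ _ _ _ => 0, fun _ _ _ _ => 0⟩
      G₁ := ⟨fun _ _ _ _ => 0, fun _ _ _ _ => 0, fun _ _ _ => 0, fun _ _ _ _ => 0, fun _ _ _ _ => 0, fun _ _ _ _ => 0⟩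
      H := ⟨fun _ _ _ _ => 0, fun _ _ _ _ => 0⟩
      H₁ := ⟨fun _ _ _ _ => 0, fun _ _ _ _ => 0⟩
      HasRWExp := fun _ _ _ => True
      HasRWExpH := fun _ _ _ => True
      PosDefK := fun _ _ => True
      GG := ⟨fun _ _ _ _ => 0, fun _ _ _ _ => 0, fun _ _ _ => 0, fun _ _ _ _ => 0, fun _ _ _ _ => 0, fun _ _ _ _ => 0⟩
      Kdiff := ⟨fun _ _ _ _ => 0, fun _ _ _ _ => 0, fun _ _ _ => 0, fun _ _ _ _ => 0, fun _ _ _ _ => 0, fun _ _ _ _ => 0⟩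
      Ck := ⟨fun _ _ _ => 0⟩
      GivenBy3185 := fun _ => True
      HasRWExpC := fun _ _ => True
      P349 := ⟨fun _ _ _ _ => 0⟩
      QGQinv := ⟨fun _ _ _ => 0⟩
      QG1Qinv := ⟨fun _ _ _ => 0⟩ }⟩

/-- **CARRIER-SUFFIX INVARIANCE, FOUR PINS**: binder B5 at the plain Stage-11 records ⟺ B5 at the `[B10] ∕ [B9] ∕ [B11] ∕ [IV]`-pinned ones.  (→) the pinned record
refines ₁₁C with the SAME datum and world (node00-def `isRecordOfRecord₁₁C_of_isRecordOfRecord₁₁CB10YZW`, XII `spine_antitone`); (←) a ₁₁C world RE-BOUND by the four-pin view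
at ANY residual layers is a pinned record with the SAME datum (`isRecordOfRecord₁₁CB10YZW_rebind_of_isRecordOfRecord₁₁C`; layers from `nonempty_opsY`, `nonempty_residZ`,
`nonempty_residW`), and B5 does not read the world (`spine_of_shadow_anyWorld`, `C`∕`av` by `rfl`). [bookkeeping] -/
theorem spine_rec11C_iff_spine_rec11CB10YZW :
    (Spine (N := N) fun F D w => Node00.IsRecordOfRecord₁₁C F N D w) ↔ Spine (N := N) fun F D w => Node00.IsRecordOfRecord₁₁CB10YZW F N D w := by
  refine ⟨spine_antitone fun F D w h => Node00.isRecordOfRecord₁₁C_of_isRecordOfRecord₁₁CB10YZW h,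
    spine_of_shadow_anyWorld fun F D w h => ?_⟩
  obtain ⟨θ, hP, -, -, hre⟩ := Node00.isRecordOfRecord₁₁CB10YZW_rebind_of_isRecordOfRecord₁₁C h
  obtain ⟨ops⟩ := nonempty_opsY N θ.toStage3Params 0
  obtain ⟨ζ⟩ := Node00.nonempty_residZ F N
  obtain ⟨lamW⟩ := Node00.nonempty_residW F N
  exact ⟨D, _, hre 0 ops ζ lamW, rfl, rfl⟩

/-- **CARRIER-SUFFIX INVARIANCE, FIVE PINS** (`[B8]` in its surviving form): B5 at the plain Stage-11 records ⟺ B5 at the fully pinned ones.  (→) a five-pin record has a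
SAME-DATUM companion in the four-pin class (node00-def `companion_of_isRecordOfRecord₁₁CB10YZWB8`), which refines ₁₁C; (←) re-bind a ₁₁C world by the S-binding at the five-pin
view (`isRecordOfRecord₁₁CB10YZWB8_rebind_of_isRecordOfRecord₁₁C`; `nonempty_residB8` for the fifth layer); both directions through `spine_of_shadow_anyWorld`. [bookkeeping] -/
theorem spine_rec11C_iff_spine_rec11CB10YZWB8 :
    (Spine (N := N) fun F D w => Node00.IsRecordOfRecord₁₁C F N D w) ↔ Spine (N := N) fun F D w => Node00.IsRecordOfRecord₁₁CB10YZWB8 F N D w := by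
  refine ⟨spine_of_shadow_anyWorld fun F D w h => ?_, spine_of_shadow_anyWorld fun F D w h => ?_⟩
  · obtain ⟨w', h', -⟩ := Node00.companion_of_isRecordOfRecord₁₁CB10YZWB8 h
    exact ⟨D, w', Node00.isRecordOfRecord₁₁C_of_isRecordOfRecord₁₁CB10YZW h', rfl, rfl⟩
  · obtain ⟨θ, hP, -, -, hre⟩ := Node00.isRecordOfRecord₁₁CB10YZWB8_rebind_of_isRecordOfRecord₁₁C h
    obtain ⟨lam⟩ := Node00.nonempty_residB8 (θ := θ.toStage3Params)
    obtain ⟨ops⟩ := nonempty_opsY N θ.toStage3Params 0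
    obtain ⟨ζ⟩ := Node00.nonempty_residZ F N
    obtain ⟨lamW⟩ := Node00.nonempty_residW F N
    exact ⟨D, _, hre lam 0 ops ζ lamW, rfl, rfl⟩

end DatumClass

/-! ## §3 K4 ∕ K5 AT ₁₁C: B5 at the Stage-11 record from the stub signatures (XIV) and from the children's reading predicates (XV), BY NAME -/

section StubsAtRecord11

variable {N : ℕ} [NeZero N] (SRec : SpineRecordPred N) (RRec : RateRecordPred N)

/-- **B5 AT THE STAGE-11 RECORD FROM THE K4 STUBS AND THE REV-1 K5**, keyed at ₁₁C: R00x (rate carriers of record exist under the pins) · N14 · N15 · N16 · N17 · N18 · N22 BY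
NAME at them · N27x · N20 · N21 · the N19′ ∃δ-edge (unpacked at the two carrier records) ⇒ `Spine ₁₁C` — XIV `spine_of_rateStubs_coreEdge` at
`Rec := Node00.IsRecordOfRecord₁₁C F N`.  Every stub is a HYPOTHESIS in the term; `SRec`, `RRec` parametric. [bookkeeping] -/
theorem spine_rec11C_of_rateStubs_coreEdge
    (hx : S_R00x (fun F D w => Node00.IsRecordOfRecord₁₁C F N D w) RRec) (h14 : S_N14 RRec) (h15 : S_N15 RRec) (h16 : S_N16 RRec)
    (h17 : S_N17 RRec) (h18 : S_N18 RRec) (h22 : S_N22 RRec) (hx' : S_N27x (fun F D w => Node00.IsRecordOfRecord₁₁C F N D w) SRec)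
    (h20 : S_N20 SRec) (h21 : S_N21 SRec)
    (h19 : ∀ (F : T4Family) (D : Datum F N) (g₀ : ℕ → ℝ) (os : List (ULoop F)) (S : SpineCarriers) (R : RateCarriers N),
      SRec F D g₀ os S → RRec F D g₀ os R → RatesAt D R → letI := S.dec
        ∃ δ : ℕ → ℝ, NE7.Core S.l₀ S.vol S.T S.Bad (fun K t τ => S.A K t τ - S.shA K t τ) (fun K t τ => S.B K t τ - S.shB K t τ) δ ∧
          Summable δ) :
    Spine (N := N) fun F D w => Node00.IsRecordOfRecord₁₁C F N D w :=
  spine_of_rateStubs_coreEdge _ SRec RRec hx h14 h15 h16 h17 h18 h22 hx' h20 h21 h19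

/-- The same with N17 GLUED from (D4) · N18 · N22 (`N17_of_U3edge`, XIV `spine_of_rateStubs_coreEdge_glueN17`) at ₁₁C. [bookkeeping] -/
theorem spine_rec11C_of_rateStubs_coreEdge_glueN17
    (hx : S_R00x (fun F D w => Node00.IsRecordOfRecord₁₁C F N D w) RRec) (h14 : S_N14 RRec) (h15 : S_N15 RRec) (h16 : S_N16 RRec)
    (h18 : S_N18 RRec) (h22 : S_N22 RRec) (hD4 : S_D4 RRec) (hx' : S_N27x (fun F D w => Node00.IsRecordOfRecord₁₁C F N D w) SRec)
    (h20 : S_N20 SRec) (h21 : S_N21 SRec)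
    (h19 : ∀ (F : T4Family) (D : Datum F N) (g₀ : ℕ → ℝ) (os : List (ULoop F)) (S : SpineCarriers) (R : RateCarriers N),
      SRec F D g₀ os S → RRec F D g₀ os R → RatesAt D R → letI := S.dec
        ∃ δ : ℕ → ℝ, NE7.Core S.l₀ S.vol S.T S.Bad (fun K t τ => S.A K t τ - S.shA K t τ) (fun K t τ => S.B K t τ - S.shB K t τ) δ ∧
          Summable δ) :
    Spine (N := N) fun F D w => Node00.IsRecordOfRecord₁₁C F N D w :=
  spine_of_rateStubs_coreEdge_glueN17 _ SRec RRec hx h14 h15 h16 h18 h22 hD4 hx' h20 h21 h19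

/-- **THE SAME STUBS KEYED AT THE STAGE-5 RECORD ⇒ B5 AT ₁₁C**: if the existence stubs R00x ∕ N27x are delivered over the (coarser) Stage-5 C-bound record class, the
join gives `Spine ₅C` (XIV) and §1's closer `spine_rec11C_of_spine_rec5C` transfers it to ₁₁C. [bookkeeping] -/
theorem spine_rec11C_of_rateStubs_coreEdge_rec5C
    (hx : S_R00x (fun F D w => Node00.IsRecordOfRecord₅C F N D w) RRec) (h14 : S_N14 RRec) (h15 : S_N15 RRec) (h16 : S_N16 RRec)
    (h17 : S_N17 RRec) (h18 : S_N18 RRec) (h22 : S_N22 RRec) (hx' : S_N27x (fun F D w => Node00.IsRecordOfRecord₅C F N D w) SRec)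
    (h20 : S_N20 SRec) (h21 : S_N21 SRec)
    (h19 : ∀ (F : T4Family) (D : Datum F N) (g₀ : ℕ → ℝ) (os : List (ULoop F)) (S : SpineCarriers) (R : RateCarriers N),
      SRec F D g₀ os S → RRec F D g₀ os R → RatesAt D R → letI := S.dec
        ∃ δ : ℕ → ℝ, NE7.Core S.l₀ S.vol S.T S.Bad (fun K t τ => S.A K t τ - S.shA K t τ) (fun K t τ => S.B K t τ - S.shB K t τ) δ ∧
          Summable δ) :
    Spine (N := N) fun F D w => Node00.IsRecordOfRecord₁₁C F N D w :=
  spine_rec11C_of_spine_rec5C (spine_of_rateStubs_coreEdge _ SRec RRec hx h14 h15 h16 h17 h18 h22 hx' h20 h21 h19)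

end StubsAtRecord11

section ReadingsAtRecord11

open T4OutputRate T4RecentScale T4GoodClassBudget T4CauchySum T4TowerRateComposition T4TowerRateDischarge
open T4EtaRateMin (Readings NE3Shape)
open T4RateLiaison (GaugeDominated)
open T4ShellMeasure (SlotLedger)
open Summit.QuantumFields.BalabanUV.T4Continuum.NE7b.PinnedExtraction (ExtractionLaws)
open Summit.QuantumFields.YangMills.BalabanUVNodes.N19LedgerLinkSync (LedgerDataSync LedgerAtSync)

variable {N : ℕ} [NeZero N] (SRec : SpineRecordPred N) (Inputs : InputsPred N)

/-- **B5 AT THE STAGE-11 RECORD FROM THE CHILDREN'S READING PREDICATES** (XV `spine_of_readings` at ₁₁C): the extraction stub `S_N27x ₁₁C SRec`, the N20 READING (two runs'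
extraction laws + the count at the bundle's carriers), the N21 READING (two slot ledgers under one geometric majorant), the N19 READING (the `LedgerAtSync` package with the
in-edges N16 ∕ N17 ∕ N18 ∕ N22 ∕ (T) BY NAME — pin-free) and K4's hook `SpineRates ₁₁C Inputs` ⇒ `Spine ₁₁C`.  Every hypothesis is what the respective child's seat states
the record must hand it. [bookkeeping] -/
theorem spine_rec11C_of_readings (hx : S_N27x (fun F D w => Node00.IsRecordOfRecord₁₁C F N D w) SRec)
    (hread20 : ∀ (F : T4Family) (D : Datum F N) (g₀ : ℕ → ℝ) (os : List (ULoop F)) (S : SpineCarriers), SRec F D g₀ os S →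
      ∃ (α α' : Type) (X : ℕ → Finset α) (Badx : ℕ → α → Finset S.ι) (q : ℕ → α → ℝ)
        (X' : ℕ → Finset α') (Badx' : ℕ → α' → Finset S.ι) (q' : ℕ → α' → ℝ),
        ExtractionLaws S.l₀ S.T S.A S.Bad X Badx q ∧ ExtractionLaws S.l₀ S.T S.B S.Bad X' Badx' q' ∧
        (∀ (K : ℕ) (t : ℝ), |t| ≤ S.l₀ → ∀ τ, 0 ≤ S.A K t τ) ∧ (∀ (K : ℕ) (t : ℝ), |t| ≤ S.l₀ → ∀ τ, 0 ≤ S.B K t τ) ∧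
        (∀ K, ∑ x ∈ X K, q K x ≤ S.W K) ∧ (∀ K, ∑ x ∈ X' K, q' K x ≤ S.W K) ∧ (∀ K, S.W K < 1) ∧ Summable S.W)
    (hread21 : ∀ (F : T4Family) (D : Datum F N) (g₀ : ℕ → ℝ) (os : List (ULoop F)) (S : SpineCarriers), SRec F D g₀ os S →
      ∃ (σA σB : Type) (SA : ℕ → Finset σA) (SB : ℕ → Finset σB) (pieceA : ℕ → ℝ → σA → S.ι → ℝ)
        (pieceB : ℕ → ℝ → σB → S.ι → ℝ) (cA : ℕ → σA → ℝ) (cB : ℕ → σB → ℝ) (C ϑ : ℝ),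
        SlotLedger S.l₀ S.T S.A S.shA SA pieceA cA ∧ SlotLedger S.l₀ S.T S.B S.shB SB pieceB cB ∧
        0 ≤ ϑ ∧ ϑ < 1 ∧ (∀ K, ∑ s ∈ SA K, cA K s ≤ C * ϑ ^ K) ∧ (∀ K, ∑ s ∈ SB K, cB K s ≤ C * ϑ ^ K) ∧
        (∀ K, ∑ s ∈ SA K, cA K s + ∑ s ∈ SB K, cB K s ≤ S.Wsh K) ∧ Summable S.Wsh)
    (hread19 : ∀ (F : T4Family) (D : Datum F N) (g₀ : ℕ → ℝ) (os : List (ULoop F)) (S : SpineCarriers),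
      SRec F D g₀ os S → Inputs F D g₀ os → letI := S.dec
      ∃ (C : Carriers) (_ : DecidableEq C.Dom) (F' : Type) (ι' X' : Type) (_ : MeasurableSpace ι')
        (L : LedgerDataSync C F' ι' S.ι) (R : Readings ι' X') (W : Set (ℕ → ℝ)) (EA : Functional C C.BgA)
        (EB : Functional C C.BgB) (κ θ₅ C₅ C₉ ω θc Cd γ C₃ θ₃ Pg : ℝ) (q : ℕ) (Λm : ℕ → ℕ → ℝ)
        (CU : (ℕ → ℝ) → ℕ → ℝ) (g : ℕ → ℕ → ℝ) (uA : ℕ → ι' → C.BgA) (uB : ℕ → ι' → C.BgB),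
        LedgerAtSync L S.l₀ S.vol S.T S.Bad (fun K t τ => S.A K t τ - S.shA K t τ) (fun K t τ => S.B K t τ - S.shB K t τ)
          R EA EB κ g uA uB ω θc θ₅ θ₃ ∧
        NE3Shape R C₃ θ₃ ∧ 0 ≤ C₃ ∧ GaugeDominated R uA uB ∧
        NE5 EA EB W κ θ₅ C₅ ∧ 0 ≤ θ₅ ∧ 0 ≤ C₅ ∧
        (NE9 EA W κ Λm ∧ T4OutputRate.FadingMemory C₉ ω Λm) ∧ 0 ≤ ω ∧
        InjectedRate Cd 0 θc (fun K j => T4CouplingMatching.disc (g K) (g (K + 1)) j) ∧ 0 ≤ Cd ∧ 0 ≤ θc ∧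
        (∀ K i, i ≤ K → 0 < g K i ∧ g K i ≤ γ) ∧
        LipBackground EA W κ CU ∧ PolyLipGrowth CU g Pg q ∧ 0 ≤ Pg ∧
        (∀ K, g K ∈ W) ∧ (∀ K, (fun i => g (K + 1) (i + 1)) ∈ W))
    (h4 : SpineRates (fun F D w => Node00.IsRecordOfRecord₁₁C F N D w) Inputs) :
    Spine (N := N) fun F D w => Node00.IsRecordOfRecord₁₁C F N D w :=
  spine_of_readings _ SRec Inputs hx hread20 hread21 hread19 h4

end ReadingsAtRecord11

/-! ## §4 The K3 SHAPE at generic `N`: «record → (B) → END → B5» IS `Spine ₁₁C` -/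

section K3Shape

variable {N : ℕ} [NeZero N]

/-- **THE REV-1 K3 SHAPE IS `Spine ₁₁C`**: «at every Stage-11 record pair, (B)(D.C) → END(D.C.toB12) → `T4ApexHybrid.HybridNE7Under D END`» ⟺ `Spine ₁₁C` — B5-under-END is
ITSELF `(B) → END → ForSmallCouplings D (g₀ ↦ StringwiseHybridNE7 (D.scheme g₀))` (`FiniteEpsData.UnderHypotheses`, definitional), so the two displayed antecedents are
discharged by B5's own (→: apply at them twice; ←: weaken).  At `N = 2` the left side is VERBATIM the route decl `Theses.BalabanUVNodes.SpineGivenEndpointR11` (rev 6);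
module XXI states that face. [bookkeeping] -/
theorem k3Shape_iff_spine_rec11C :
    (∀ (F : T4Family) (D : Datum F N) (w : DagBinding.WorldP), Node00.IsRecordOfRecord₁₁C F N D w →
      B16.EndStatementBPrinted D.C → DagBinding.EndpointExistence D.C.toB12 →
        T4ApexHybrid.HybridNE7Under D (DagBinding.EndpointExistence D.C.toB12)) ↔
    Spine (N := N) fun F D w => Node00.IsRecordOfRecord₁₁C F N D w := by
  refine ⟨fun h F D w hR => ?_, fun h F D w hR _ _ => h F D w hR⟩
  show D.UnderHypotheses _ fun g₀ => T4ApexHybrid.StringwiseHybridNE7 (D.scheme g₀)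
  intro hB hEnd
  exact h F D w hR hB hEnd hB hEnd

end K3Shape

end Summit.QuantumFields.YangMills.Theorems.BalabanUVNodesN27SpineRecord
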